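import Mathlib
import HarnessLib
import Literature.NumberTheory.Transcendental.KZCalculus
import Literature.NumberTheory.Transcendental.KZProduct
import Literature.NumberTheory.Transcendental.SemialgebraicMaps
import Summits.KontsevichZagierPeriods.KontsevichZagierPeriods.Theses.LinRedNormalForm

/-!
# Line `tame-bv-stokes` — skeleton for crux `DihedralNormalForm` (stmt-KontsevichZagierPeriods-3912)

Second-lineage lead's skeleton of line `tame-bv-stokes` (planner
`planner-cruxplan-stmt-KontsevichZagierPeriods-391-tame-bv-stokes-0`, planner skeleton sha
`522d64ac0fe6`), REBUILT by the lead from the six stub signatures archived on the crux item (the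
planner's `Lines/tame-bv-stokes.lean` was never published under `Cruxes/DihedralNormalForm/Lines/`
and the gate evidence store is not mounted in the lead's jail). Five stubs verbatim from the
planner (`stub_bvStokes`, `stub_boundedStokesMove`, `stub_exactToFaces`, `stub_cellZetaMoves`,
`stub_productClosure`); the ENTRANCE stub `stub_atomReduction` is taken with the signature
registered by the FIRST lineage (line `torus-descent-sum-shadow`, ℕ-exponent cubical atoms), so
that one proof serves both lines; the composition `DihedralNormalForm_of` is sorry-free.

## Objects

* `WordRep` — the crux's target generators: MZV word representations `[Δ_w, q · ∏ ω_{εᵢ}(tᵢ)]`.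
* `CubRep k` — cubical representations `[□ᵏ, q · xᵃ · ∏_{i ≤ j} (1 − x_i ⋯ x_j)^{e i j}]` on the
  OPEN unit cube, `a ∈ ℤᵏ`, `e ∈ ℤ` (absolutely convergent: they are `KZ.IntegralRep`s);
  `AtomN k` — the same with `a ∈ ℕᵏ` (the first lineage's atoms; `AtomN k ⊆ CubRep k`).
* `LogRep ℓ` — representations on the open ordered simplex `Δ_ℓ` whose integrand is a
  `ℚ`-combination of bar/Arnold products `∏ᵢ (tᵢ − aᵢ)⁻¹`, `aᵢ ∈ {0, 1, t₀, …, t_{i−1}}`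
  (convergent combinations of top-degree logarithmic forms of `M_{0,ℓ+3}` restricted to the cell).

## The chain

`stub_atomReduction : crux input ↦ closure (AtomN k) ⊆ closure (CubRep k)` (cubical chart, rule 2;
Brown's convergence lemma, rule 1b) ·
`stub_bvStokes` (o-minimal bounded variation: a bounded `ℚ`-semialgebraic function differentiable
on the open cube has absolutely integrable coordinate derivatives) ·
`stub_boundedStokesMove` (Stokes on the open cube for `Σᵢ ∂ᵢ hᵢ` with bounded semialgebraic `hᵢ`
continuous on closed fibres = `(k+1)` reindexings + `(k+1)` Newton–Leibniz moves + integrand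
additivity) ·
`stub_exactToFaces : CubRep (ℓ+1) ↦ relations ⊔ closure (LogRep (ℓ+1) ∪ CubRep ℓ)` (algebraic de
Rham reduction on Brown's `M^δ`: an atom minus its projection to the convergent log forms is `d` of
a form with BOUNDED regular coefficients, whose Stokes chain is legal by the previous stub and whose
face terms are cubical representations one dimension down) ·
`stub_cellZetaMoves : LogRep ℓ ↦ relations ⊔ closure (WordRep ∪ products of lower LogRep)` (the
word-surjectivity half of the Brown–Carr–Schneps cell-zeta picture: dihedral relabellings = rule 2,
product maps = shuffle dissections, polygon identities = rule 1b) ·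
`stub_productClosure` (`relations ⊔ closure WordRep` is closed under `IntegralRep.prod`: ideal
property of `relations` + the shuffle dissection of a product of simplices).
Composition: strong induction on the dimension `ℓ` (`CubRep 0 ⊆ WordRep` are the constants).
-/

noncomputable section

set_option linter.dupNamespace false

open MeasureTheory Set

namespace Summit.KontsevichZagierPeriods.KontsevichZagierPeriods.Cruxes.DihedralNormalForm.TameBVStokes

open Literature.NumberTheory.Transcendental
open Summit.KontsevichZagierPeriods.KontsevichZagierPeriods.Theses.LinRedNormalForm (DihedralNormalForm)

/-! ## The generator sets -/

/-- The crux's target generators: MZV word representations `[Δ_w, q · ∏ ω_{εᵢ}(tᵢ)]`. -/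
abbrev WordRep : Set KZ.FormalRep :=
  {x : Literature.NumberTheory.Transcendental.KZ.FormalRep | ∃ (w : ℕ) (ε : Fin w → Bool) (q : ℚ) (s : Literature.NumberTheory.Transcendental.KZ.IntegralRep w), s.domain = {t : Fin w → ℝ | (∀ i, 0 < t i) ∧ (∀ i, t i < 1) ∧ StrictAnti t} ∧ Set.EqOn s.integrand (fun t => (q : ℝ) * ∏ i, if ε i then 1 / (1 - t i) else 1 / t i) s.domain ∧ x = Literature.NumberTheory.Transcendental.KZ.of s}

/-- Cubical representations of dimension `k` with integer exponents (module docstring). -/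
abbrev CubRep (k : ℕ) : Set KZ.FormalRep :=
  {y : Literature.NumberTheory.Transcendental.KZ.FormalRep | ∃ (q : ℚ) (a : Fin k → ℤ) (e : Fin k → Fin k → ℤ) (s : Literature.NumberTheory.Transcendental.KZ.IntegralRep k), s.domain = {x : Fin k → ℝ | ∀ i, x i ∈ Set.Ioo (0:ℝ) 1} ∧ Set.EqOn s.integrand (fun x => (q : ℝ) * ((∏ i, x i ^ a i) * ∏ i, ∏ j, if i ≤ j then (1 - ∏ l, if i ≤ l ∧ l ≤ j then x l else 1) ^ e i j else 1)) s.domain ∧ y = Literature.NumberTheory.Transcendental.KZ.of s}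

/-- The first lineage's cubical ATOMS (natural-number exponents). -/
abbrev AtomN (k : ℕ) : Set KZ.FormalRep :=
  {z : Literature.NumberTheory.Transcendental.KZ.FormalRep | ∃ (q : ℚ) (a : Fin k → ℕ) (e : Fin k → Fin k → ℤ) (s : Literature.NumberTheory.Transcendental.KZ.IntegralRep k), s.domain = {x : Fin k → ℝ | ∀ i, x i ∈ Set.Ioo (0:ℝ) 1} ∧ Set.EqOn s.integrand (fun x => (q : ℝ) * ((∏ i : Fin k, x i ^ a i) * ∏ i : Fin k, ∏ j : Fin k, if i ≤ j then (1 - (∏ l : Fin k, if i ≤ l ∧ l ≤ j then x l else 1)) ^ e i j else 1)) s.domain ∧ z = Literature.NumberTheory.Transcendental.KZ.of s}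

/-- Convergent `ℚ`-combinations of bar/Arnold products on the open ordered simplex `Δ_ℓ`. -/
abbrev LogRep (ℓ : ℕ) : Set KZ.FormalRep :=
  {y : Literature.NumberTheory.Transcendental.KZ.FormalRep | ∃ (q : (Fin ℓ → Fin (ℓ + 2)) → ℚ) (s : Literature.NumberTheory.Transcendental.KZ.IntegralRep ℓ), s.domain = {t : Fin ℓ → ℝ | (∀ i, 0 < t i) ∧ (∀ i, t i < 1) ∧ StrictAnti t} ∧ Set.EqOn s.integrand (fun t => ∑ f : Fin ℓ → Fin (ℓ + 2), (q f : ℝ) * ∏ i : Fin ℓ, 1 / (t i - (if ((f i : Fin (ℓ + 2)) : ℕ) = 0 then (0:ℝ) else if ((f i : Fin (ℓ + 2)) : ℕ) = 1 then 1 else if h : ((f i : Fin (ℓ + 2)) : ℕ) - 2 < (i : ℕ) then t ⟨((f i : Fin (ℓ + 2)) : ℕ) - 2, lt_trans h i.isLt⟩ else 0))) s.domain ∧ y = Literature.NumberTheory.Transcendental.KZ.of s}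

/-! ## The six stubs (signatures verbatim as registered) -/

/-- **stub_atomReduction** (L; SHARED with line `torus-descent-sum-shadow`, registered by the first lineage). ENTRANCE: the cubical chart `tᵢ = x₀ x₁ ⋯ xᵢ` (rule 2, polynomial map, injective on the open cube, Jacobian `∏ xᵢ^{k-1-i}`, image the open ordered simplex) carries a genus-zero representation to the open cube, where the integrand is `P(x)·x^{-B}·∏(1 - x_I)^{-e_I}` over interval chords `I`; Brown's convergence lemma (ENS 2009, §7: absolute convergence forces the dihedral-coordinate expansion to be polynomial) splits it into a `ℚ`-combination of CONVERGENT atoms (rule 1b, every term convergent). -/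
theorem stub_atomReduction : ∀ (k : ℕ) (r : Literature.NumberTheory.Transcendental.KZ.IntegralRep k) (p : MvPolynomial (Fin k) ℚ) (a : Fin k → Fin k → ℕ) (b c : Fin k → ℕ), r.domain = {t | (∀ i, 0 < t i) ∧ (∀ i, t i < 1) ∧ StrictAnti t} → Set.EqOn r.integrand (fun t => MvPolynomial.aeval t p / ((∏ i, t i ^ b i) * (∏ i, (1 - t i) ^ c i) * ∏ i, ∏ j, if i < j then (t i - t j) ^ a i j else 1)) r.domain → ∃ m ∈ AddSubgroup.closure {z : Literature.NumberTheory.Transcendental.KZ.FormalRep | ∃ (q : ℚ) (a : Fin k → ℕ) (e : Fin k → Fin k → ℤ) (s : Literature.NumberTheory.Transcendental.KZ.IntegralRep k), s.domain = {x : Fin k → ℝ | ∀ i, x i ∈ Set.Ioo (0:ℝ) 1} ∧ Set.EqOn s.integrand (fun x => (q : ℝ) * ((∏ i : Fin k, x i ^ a i) * ∏ i : Fin k, ∏ j : Fin k, if i ≤ j then (1 - (∏ l : Fin k, if i ≤ l ∧ l ≤ j then x l else 1)) ^ e i j else 1)) s.domain ∧ z = Literature.NumberTheory.Transcendental.KZ.of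 s}, Literature.NumberTheory.Transcendental.KZ.of r - m ∈ Literature.NumberTheory.Transcendental.KZ.relations := by
  sorry

/-- **stub_bvStokes** (M–L). TAME BOUNDED VARIATION: a `ℚ`-semialgebraic `h`, bounded by `C` and differentiable on the open cube, has absolutely integrable `i`-th partial derivative. Fibrewise in the coordinate `i`: `∂ᵢh` is semialgebraic (`IsSemialgebraicFunOn.fderiv_apply_single`), the frontier points of the fibres of `{∂ᵢh > 0}`, `{∂ᵢh < 0}` form a semialgebraic family of finite sets, hence of uniformly bounded size `N` (`IsSemialgebraic.exists_forall_encard_fibre_le`); on each of the `≤ 2N+1` complementary intervals `t ↦ h` is monotone, so `∫ |∂ₜ h| ≤ 2C` there (`intervalIntegral.integrableOn_deriv_of_nonneg`, FTC); Tonelli along `MeasurableEquiv.piFinSuccAbove _ i`. -/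
theorem stub_bvStokes : ∀ (k : ℕ) (i : Fin (k + 1)) (h : (Fin (k + 1) → ℝ) → ℝ) (C : ℝ), Literature.NumberTheory.Transcendental.IsSemialgebraicFunOn ℚ {x : Fin (k + 1) → ℝ | ∀ i, x i ∈ Set.Ioo (0:ℝ) 1} h → (∀ x ∈ {x : Fin (k + 1) → ℝ | ∀ i, x i ∈ Set.Ioo (0:ℝ) 1}, |h x| ≤ C) → (∀ x ∈ {x : Fin (k + 1) → ℝ | ∀ i, x i ∈ Set.Ioo (0:ℝ) 1}, DifferentiableAt ℝ h x) → MeasureTheory.IntegrableOn (fun x => fderiv ℝ h x (Pi.single i 1)) {x : Fin (k + 1) → ℝ | ∀ i, x i ∈ Set.Ioo (0:ℝ) 1} := by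
  sorry

/-- **stub_boundedStokesMove** (L). STOKES ON THE OPEN CUBE AS MOVES: for bounded `ℚ`-semialgebraic `hᵢ` (semialgebraic on the closed cube, differentiable inside, continuous on each closed `i`-fibre) the representation of `Σᵢ ∂ᵢhᵢ` on the open cube minus `Σᵢ ([□ᵏ, hᵢ|_{xᵢ=1}] − [□ᵏ, hᵢ|_{xᵢ=0}])` is a relation: integrand additivity (rule 1b; each `∂ᵢhᵢ` is integrable by the BV hypothesis and semialgebraic by `IsSemialgebraicFunOn.fderiv_apply_single`), then for each `i` the reindexing moving coordinate `i` last (`KZ.of_sub_of_reindex_mem_relations`, rule 2), closed versus open fibres (`KZ.of_sub_of_restrict_openBand_mem_relations`), ONE Newton–Leibniz move with primitive `hᵢ` itself (rule 3, base `□ᵏ`, `a = 0`, `b = 1`), and integrand additivity on the base. -/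
theorem stub_boundedStokesMove : (∀ (k : ℕ) (i : Fin (k + 1)) (h : (Fin (k + 1) → ℝ) → ℝ) (C : ℝ), Literature.NumberTheory.Transcendental.IsSemialgebraicFunOn ℚ {x : Fin (k + 1) → ℝ | ∀ i, x i ∈ Set.Ioo (0:ℝ) 1} h → (∀ x ∈ {x : Fin (k + 1) → ℝ | ∀ i, x i ∈ Set.Ioo (0:ℝ) 1}, |h x| ≤ C) → (∀ x ∈ {x : Fin (k + 1) → ℝ | ∀ i, x i ∈ Set.Ioo (0:ℝ) 1}, DifferentiableAt ℝ h x) → MeasureTheory.IntegrableOn (fun x => fderiv ℝ h x (Pi.single i 1)) {x : Fin (k + 1) → ℝ | ∀ i, x i ∈ Set.Ioo (0:ℝ) 1}) → ∀ (k : ℕ) (h : Fin (k + 1) → (Fin (k + 1) → ℝ) → ℝ) (C : ℝ) (r : Literature.NumberTheory.Transcendental.KZ.IntegralRep (k + 1)) (f₀ f₁ : Fin (k + 1) → Literature.NumberTheory.Transcendental.KZ.IntegralRep k), (∀ i, Literature.NumberTheory.Transcendental.IsSemialgebraicFunOn ℚ {x : Fin (k + 1) → ℝ | ∀ i, x i ∈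 Set.Icc (0:ℝ) 1} (h i)) → (∀ i, ∀ x ∈ {x : Fin (k + 1) → ℝ | ∀ i, x i ∈ Set.Ioo (0:ℝ) 1}, |h i x| ≤ C) → (∀ i, ∀ x ∈ {x : Fin (k + 1) → ℝ | ∀ i, x i ∈ Set.Ioo (0:ℝ) 1}, DifferentiableAt ℝ (h i) x) → (∀ i, ∀ y ∈ {x : Fin k → ℝ | ∀ i, x i ∈ Set.Ioo (0:ℝ) 1}, ContinuousOn (fun t : ℝ => h i (Fin.insertNth i t y)) (Set.Icc 0 1)) → r.domain = {x : Fin (k + 1) → ℝ | ∀ i, x i ∈ Set.Ioo (0:ℝ) 1} → Set.EqOn r.integrand (fun x => ∑ i, fderiv ℝ (h i) x (Pi.single i 1)) r.domain → (∀ i, (f₀ i).domain = {x : Fin k → ℝ | ∀ i, x i ∈ Set.Ioo (0:ℝ) 1} ∧ (f₁ i).domain = {x : Fin k → ℝ | ∀ i, x i ∈ Set.Ioo (0:ℝ) 1} ∧ Set.EqOn (f₀ i).integrand (fun y => h i (Fin.insertNth i 0 y)) {x : Fin k → ℝ | ∀ i, x i ∈ Set.Ioo (0:ℝ) 1} ∧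 Set.EqOn (f₁ i).integrand (fun y => h i (Fin.insertNth i 1 y)) {x : Fin k → ℝ | ∀ i, x i ∈ Set.Ioo (0:ℝ) 1}) → Literature.NumberTheory.Transcendental.KZ.of r - ∑ i, (Literature.NumberTheory.Transcendental.KZ.of (f₁ i) - Literature.NumberTheory.Transcendental.KZ.of (f₀ i)) ∈ Literature.NumberTheory.Transcendental.KZ.relations := by
  sorry

/-- **stub_exactToFaces** (XL). DE RHAM REDUCTION ON `M^δ`: modulo the bounded Stokes move, every cubical representation of dimension `ℓ+1` is a `ℤ`-combination of convergent bar-form representations on `Δ_{ℓ+1}` (through the inverse cubical chart, rule 2) and of cubical representations of dimension `ℓ` (the face terms `hᵢ|_{xᵢ = 0,1}`, which are atoms in the remaining coordinates): the class of a convergent atom in `H^{ℓ+1}(M^δ_{0,ℓ+4})` is represented by convergent logarithmic forms (Brown–Carr–Schneps 2010, Thm 4.9), and the difference is `d` of an `ℓ`-form with coefficients regular on `M^δ`, i.e. polynomial in Brown's `u_{ij}` and BOUNDED on the closed cell, chart by chart (Brown ENS 2009, Prop. 2.22, Lemma 2.24, Lemma 7.4). -/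
theorem stub_exactToFaces (CubRep : ℕ → Set Literature.NumberTheory.Transcendental.KZ.FormalRep) (hCubRep : ∀ k, CubRep k = {y : Literature.NumberTheory.Transcendental.KZ.FormalRep | ∃ (q : ℚ) (a : Fin k → ℤ) (e : Fin k → Fin k → ℤ) (s : Literature.NumberTheory.Transcendental.KZ.IntegralRep k), s.domain = {x : Fin k → ℝ | ∀ i, x i ∈ Set.Ioo (0:ℝ) 1} ∧ Set.EqOn s.integrand (fun x => (q : ℝ) * ((∏ i, x i ^ a i) * ∏ i, ∏ j, if i ≤ j then (1 - ∏ l, if i ≤ l ∧ l ≤ j then x l else 1) ^ e i j else 1)) s.domain ∧ y = Literature.NumberTheory.Transcendental.KZ.of s}) (LogRep : ℕ → Set Literature.NumberTheory.Transcendental.KZ.FormalRep) (hLogRep : ∀ ℓ, LogRep ℓ = {y : Literature.NumberTheory.Transcendental.KZ.FormalRep | ∃ (q : (Fin ℓ → Fin (ℓ + 2)) → ℚ) (s : Literature.NumberTheory.Transcendental.KZ.IntegralRep ℓ), s.domain = {t : Fin ℓ → ℝ | (∀ i, 0 < t i) ∧ (∀ i, t i < 1) ∧ StrictAnti t} ∧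 Set.EqOn s.integrand (fun t => ∑ f : Fin ℓ → Fin (ℓ + 2), (q f : ℝ) * ∏ i : Fin ℓ, 1 / (t i - (if ((f i : Fin (ℓ + 2)) : ℕ) = 0 then (0:ℝ) else if ((f i : Fin (ℓ + 2)) : ℕ) = 1 then 1 else if h : ((f i : Fin (ℓ + 2)) : ℕ) - 2 < (i : ℕ) then t ⟨((f i : Fin (ℓ + 2)) : ℕ) - 2, lt_trans h i.isLt⟩ else 0))) s.domain ∧ y = Literature.NumberTheory.Transcendental.KZ.of s}) : (∀ (k : ℕ) (h : Fin (k + 1) → (Fin (k + 1) → ℝ) → ℝ) (C : ℝ) (r : Literature.NumberTheory.Transcendental.KZ.IntegralRep (k + 1)) (f₀ f₁ : Fin (k + 1) → Literature.NumberTheory.Transcendental.KZ.IntegralRep k), (∀ i, Literature.NumberTheory.Transcendental.IsSemialgebraicFunOn ℚ {x : Fin (k + 1) → ℝ | ∀ i, x i ∈ Set.Icc (0:ℝ) 1} (h i)) → (∀ i, ∀ x ∈ {x : Fin (k + 1) → ℝ | ∀ i, x i ∈ Set.Ioo (0:ℝ) 1}, |h i x| ≤ C) → (∀ i, ∀ x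 ∈ {x : Fin (k + 1) → ℝ | ∀ i, x i ∈ Set.Ioo (0:ℝ) 1}, DifferentiableAt ℝ (h i) x) → (∀ i, ∀ y ∈ {x : Fin k → ℝ | ∀ i, x i ∈ Set.Ioo (0:ℝ) 1}, ContinuousOn (fun t : ℝ => h i (Fin.insertNth i t y)) (Set.Icc 0 1)) → r.domain = {x : Fin (k + 1) → ℝ | ∀ i, x i ∈ Set.Ioo (0:ℝ) 1} → Set.EqOn r.integrand (fun x => ∑ i, fderiv ℝ (h i) x (Pi.single i 1)) r.domain → (∀ i, (f₀ i).domain = {x : Fin k → ℝ | ∀ i, x i ∈ Set.Ioo (0:ℝ) 1} ∧ (f₁ i).domain = {x : Fin k → ℝ | ∀ i, x i ∈ Set.Ioo (0:ℝ) 1} ∧ Set.EqOn (f₀ i).integrand (fun y => h i (Fin.insertNth i 0 y)) {x : Fin k → ℝ | ∀ i, x i ∈ Set.Ioo (0:ℝ) 1} ∧ Set.EqOn (f₁ i).integrand (fun y => h i (Fin.insertNth i 1 y)) {x : Fin k → ℝ | ∀ i, x i ∈ Set.Ioo (0:ℝ) 1}) → Literature.NumberTheory.Transcendental.KZ.of r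 - ∑ i, (Literature.NumberTheory.Transcendental.KZ.of (f₁ i) - Literature.NumberTheory.Transcendental.KZ.of (f₀ i)) ∈ Literature.NumberTheory.Transcendental.KZ.relations) → ∀ (ℓ : ℕ), ∀ y ∈ CubRep (ℓ + 1), y ∈ Literature.NumberTheory.Transcendental.KZ.relations ⊔ AddSubgroup.closure (LogRep (ℓ + 1) ∪ CubRep ℓ) := by
  sorry

/-- **stub_cellZetaMoves** (XL, HARDEST — held by the lead). WORD SURJECTIVITY: every convergent bar-form combination on `Δ_ℓ` is, modulo relations, a `ℤ`-combination of MZV word representations and of products of two such combinations of smaller positive dimensions (Brown–Carr–Schneps 2010: insertion basis Thm 4.9, the relation families of Def. 2.27/2.28 — dihedral relabellings of the cell (rule 2), product maps along forgetful morphisms = shuffle dissections (rules 1a + 2), linear polygon identities (rule 1b) — and their machine verification of FC_{n-3} for n ≤ 9, §4.4). -/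
theorem stub_cellZetaMoves (LogRep : ℕ → Set Literature.NumberTheory.Transcendental.KZ.FormalRep) (hLogRep : ∀ ℓ, LogRep ℓ = {y : Literature.NumberTheory.Transcendental.KZ.FormalRep | ∃ (q : (Fin ℓ → Fin (ℓ + 2)) → ℚ) (s : Literature.NumberTheory.Transcendental.KZ.IntegralRep ℓ), s.domain = {t : Fin ℓ → ℝ | (∀ i, 0 < t i) ∧ (∀ i, t i < 1) ∧ StrictAnti t} ∧ Set.EqOn s.integrand (fun t => ∑ f : Fin ℓ → Fin (ℓ + 2), (q f : ℝ) * ∏ i : Fin ℓ, 1 / (t i - (if ((f i : Fin (ℓ + 2)) : ℕ) = 0 then (0:ℝ) else if ((f i : Fin (ℓ + 2)) : ℕ) = 1 then 1 else if h : ((f i : Fin (ℓ + 2)) : ℕ) - 2 < (i : ℕ) then t ⟨((f i : Fin (ℓ + 2)) : ℕ) - 2, lt_trans h i.isLt⟩ else 0))) s.domain ∧ y = Literature.NumberTheory.Transcendental.KZ.of s}) : ∀ (ℓ : ℕ), ∀ y ∈ LogRep ℓ, y ∈ Literature.NumberTheory.Transcendental.KZ.relations ⊔ AddSubgroup.closure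 ({x : Literature.NumberTheory.Transcendental.KZ.FormalRep | ∃ (w : ℕ) (ε : Fin w → Bool) (q : ℚ) (s : Literature.NumberTheory.Transcendental.KZ.IntegralRep w), s.domain = {t : Fin w → ℝ | (∀ i, 0 < t i) ∧ (∀ i, t i < 1) ∧ StrictAnti t} ∧ Set.EqOn s.integrand (fun t => (q : ℝ) * ∏ i, if ε i then 1 / (1 - t i) else 1 / t i) s.domain ∧ x = Literature.NumberTheory.Transcendental.KZ.of s} ∪ {y : Literature.NumberTheory.Transcendental.KZ.FormalRep | ∃ (a b : ℕ) (s₁ : Literature.NumberTheory.Transcendental.KZ.IntegralRep a) (s₂ : Literature.NumberTheory.Transcendental.KZ.IntegralRep b), a + b = ℓ ∧ 0 < a ∧ 0 < b ∧ Literature.NumberTheory.Transcendental.KZ.of s₁ ∈ LogRep a ∧ Literature.NumberTheory.Transcendental.KZ.of s₂ ∈ LogRep b ∧ y = Literature.NumberTheory.Transcendental.KZ.of (s₁.prod s₂)}) := by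
  sorry

/-- **stub_productClosure** (M–L). PRODUCTS OF NORMAL FORMS ARE NORMAL FORMS: `relations ⊔ closure WordRep` is closed under the product of representations — `KZ.of (s₁.prod s₂) = KZ.of s₁ * KZ.of s₂` (`KZ.of_mul_of`), `relations` is a two-sided ideal (`KZ.mul_mem_relations_left_holds`, `KZ.mul_mem_relations_right_holds`), and a product of two word representations is a sum of word representations by the shuffle dissection of `Δ_a × Δ_b` (rules 1a + 2; `ShuffleProductInKZ` of Theorems/MzvKernelInKZTwoPosetsShuffleProduct.lean; empty and non-admissible words: constants resp. zero integrands). -/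
theorem stub_productClosure : ∀ (a b : ℕ) (s₁ : Literature.NumberTheory.Transcendental.KZ.IntegralRep a) (s₂ : Literature.NumberTheory.Transcendental.KZ.IntegralRep b), Literature.NumberTheory.Transcendental.KZ.of s₁ ∈ Literature.NumberTheory.Transcendental.KZ.relations ⊔ AddSubgroup.closure {x : Literature.NumberTheory.Transcendental.KZ.FormalRep | ∃ (w : ℕ) (ε : Fin w → Bool) (q : ℚ) (s : Literature.NumberTheory.Transcendental.KZ.IntegralRep w), s.domain = {t : Fin w → ℝ | (∀ i, 0 < t i) ∧ (∀ i, t i < 1) ∧ StrictAnti t} ∧ Set.EqOn s.integrand (fun t => (q : ℝ) * ∏ i, if ε i then 1 / (1 - t i) else 1 / t i) s.domain ∧ x = Literature.NumberTheory.Transcendental.KZ.of s} → Literature.NumberTheory.Transcendental.KZ.of s₂ ∈ Literature.NumberTheory.Transcendental.KZ.relations ⊔ AddSubgroup.closure {x : Literature.NumberTheory.Transcendental.KZ.FormalRep | ∃ (w : ℕ) (ε : Fin w → Bool) (q : ℚ) (s : Literature.NumberTheory.Transcendental.KZ.IntegralRep w), s.domain = {t : Fin w → ℝ | (∀ i, 0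 < t i) ∧ (∀ i, t i < 1) ∧ StrictAnti t} ∧ Set.EqOn s.integrand (fun t => (q : ℝ) * ∏ i, if ε i then 1 / (1 - t i) else 1 / t i) s.domain ∧ x = Literature.NumberTheory.Transcendental.KZ.of s} → Literature.NumberTheory.Transcendental.KZ.of (s₁.prod s₂) ∈ Literature.NumberTheory.Transcendental.KZ.relations ⊔ AddSubgroup.closure {x : Literature.NumberTheory.Transcendental.KZ.FormalRep | ∃ (w : ℕ) (ε : Fin w → Bool) (q : ℚ) (s : Literature.NumberTheory.Transcendental.KZ.IntegralRep w), s.domain = {t : Fin w → ℝ | (∀ i, 0 < t i) ∧ (∀ i, t i < 1) ∧ StrictAnti t} ∧ Set.EqOn s.integrand (fun t => (q : ℝ) * ∏ i, if ε i then 1 / (1 - t i) else 1 / t i) s.domain ∧ x = Literature.NumberTheory.Transcendental.KZ.of s} := by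
  sorry

/-! ## Composition (sorry-free) -/

/-- The working subgroup: relations plus the `ℤ`-span of the MZV word representations. -/
abbrev RW : AddSubgroup KZ.FormalRep := KZ.relations ⊔ AddSubgroup.closure WordRep

theorem relations_le_RW : KZ.relations ≤ RW := le_sup_left

theorem wordRep_subset_RW : WordRep ⊆ (RW : Set KZ.FormalRep) := fun _ hx =>
  (le_sup_right : AddSubgroup.closure WordRep ≤ RW) (AddSubgroup.subset_closure hx)

/-- The first lineage's atoms are cubical representations (cast the exponents to `ℤ`). -/
theorem atomN_subset_cubRep (k : ℕ) : AtomN k ⊆ CubRep k := by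
  rintro z ⟨q, a, e, s, hdom, hint, rfl⟩
  refine ⟨q, fun i => (a i : ℤ), e, s, hdom, ?_, rfl⟩
  intro x hx
  rw [hint hx]
  simp only [zpow_natCast]

/-- Dimension zero: a cubical representation of dimension `0` is a word representation (the
empty word: both domains are the one-point space, both integrands the constant `q`). -/
theorem cubRep_zero_subset_wordRep : CubRep 0 ⊆ WordRep := by
  rintro y ⟨q, a, e, s, hdom, hint, rfl⟩
  refine ⟨0, Fin.elim0, q, s, ?_, ?_, rfl⟩
  · rw [hdom]
    ext t
    simp only [Set.mem_setOf_eq, IsEmpty.forall_iff, true_and]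
    exact ⟨fun _ => fun i => i.elim0, fun _ => trivial⟩
  · intro t ht
    rw [hint ht]
    simp

/-- The product generators of `stub_cellZetaMoves` lie in `RW` once the lower `LogRep` do. -/
theorem prod_mem_RW {ℓ : ℕ} (ih : ∀ d < ℓ, LogRep d ⊆ (RW : Set KZ.FormalRep)) :
    {y : Literature.NumberTheory.Transcendental.KZ.FormalRep | ∃ (a b : ℕ) (s₁ : Literature.NumberTheory.Transcendental.KZ.IntegralRep a) (s₂ : Literature.NumberTheory.Transcendental.KZ.IntegralRep b), a + b = ℓ ∧ 0 < a ∧ 0 < b ∧ Literature.NumberTheory.Transcendental.KZ.of s₁ ∈ LogRep a ∧ Literature.NumberTheory.Transcendental.KZ.of s₂ ∈ LogRep b ∧ y = Literature.NumberTheory.Transcendental.KZ.of (s₁.prod s₂)} ⊆ (RW : Set KZ.FormalRep) := by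
  rintro y ⟨a, b, s₁, s₂, hab, ha, hb, h₁, h₂, rfl⟩
  have ha' : a < ℓ := by omega
  have hb' : b < ℓ := by omega
  exact stub_productClosure a b s₁ s₂ (ih a ha' h₁) (ih b hb' h₂)

/-- The main induction: every `LogRep ℓ` and every `CubRep ℓ` lies in `RW`. -/
theorem logRep_cubRep_subset_RW : ∀ ℓ : ℕ, LogRep ℓ ⊆ (RW : Set KZ.FormalRep) ∧ CubRep ℓ ⊆ (RW : Set KZ.FormalRep) := by
  intro ℓ
  induction ℓ using Nat.strong_induction_on with
  | _ ℓ ih =>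
    -- the log forms of dimension `ℓ`
    have hLog : LogRep ℓ ⊆ (RW : Set KZ.FormalRep) := by
      intro y hy
      have h := stub_cellZetaMoves LogRep (fun _ => rfl) ℓ y hy
      have hle : AddSubgroup.closure (WordRep ∪ {y : Literature.NumberTheory.Transcendental.KZ.FormalRep | ∃ (a b : ℕ) (s₁ : Literature.NumberTheory.Transcendental.KZ.IntegralRep a) (s₂ : Literature.NumberTheory.Transcendental.KZ.IntegralRep b), a + b = ℓ ∧ 0 < a ∧ 0 < b ∧ Literature.NumberTheory.Transcendental.KZ.of s₁ ∈ LogRep a ∧ Literature.NumberTheory.Transcendental.KZ.of s₂ ∈ LogRep b ∧ y = Literature.NumberTheory.Transcendental.KZ.of (s₁.prod s₂)}) ≤ RW := by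
        rw [AddSubgroup.closure_le]
        exact Set.union_subset wordRep_subset_RW (prod_mem_RW fun d hd => (ih d hd).1)
      exact (sup_le relations_le_RW hle) h
    refine ⟨hLog, ?_⟩
    -- the cubical representations of dimension `ℓ`
    cases ℓ with
    | zero => exact cubRep_zero_subset_wordRep.trans wordRep_subset_RW
    | succ ℓ' =>
      intro y hy
      have h := stub_exactToFaces CubRep (fun _ => rfl) LogRep (fun _ => rfl)
        (stub_boundedStokesMove stub_bvStokes) ℓ' y hy
      have hle : AddSubgroup.closure (LogRep (ℓ' + 1) ∪ CubRep ℓ') ≤ RW := by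
        rw [AddSubgroup.closure_le]
        exact Set.union_subset hLog (ih ℓ' (Nat.lt_succ_self ℓ')).2
      exact (sup_le relations_le_RW hle) h

/-- **The crux from the stubs.** -/
theorem DihedralNormalForm_of : DihedralNormalForm := by
  intro k r p a b c hdom hint
  obtain ⟨m₀, hm₀, hrel⟩ := stub_atomReduction k r p a b c hdom hint
  -- the atoms of the entrance stub lie in `RW`
  have hle : AddSubgroup.closure (AtomN k) ≤ RW := by
    rw [AddSubgroup.closure_le]
    exact (atomN_subset_cubRep k).trans (logRep_cubRep_subset_RW k).2
  obtain ⟨y, hy, z, hz, hyz⟩ := AddSubgroup.mem_sup.1 (hle hm₀)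
  refine ⟨z, hz, ?_⟩
  have : Literature.NumberTheory.Transcendental.KZ.of r - z = (Literature.NumberTheory.Transcendental.KZ.of r - m₀) + y := by
    rw [← hyz]; abel
  rw [this]
  exact add_mem hrel hy

end Summit.KontsevichZagierPeriods.KontsevichZagierPeriods.Cruxes.DihedralNormalForm.TameBVStokes
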